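import Summits.Ventures.PercRepro.S1TriangleCountBoot

/-!
# PercRepro — THE TRIANGLE KERNEL AT NULLITY `4`: `s₃ ≤ 6` under (C1) and (C2) (p8, gen 22; a feeder for S4 — the top
of the `q = 7` window, the row `42`)

The bootstrapped triangle count (S1TriangleCountBoot) gives `s₃ ≤ triBound 4 = 7` at nullity `4`. The value `7` is
never attained: at nullity `4` the bootstrap's own inequalities — `s₃ ≤ m + s₃(M ＼ {x}) ≤ m + 4` at the point `x` on the
fewest triangles (`m := t_x`, `triBound 3 = 4`) and the double count `m(2m + 1) ≤ |U|·m ≤ 3·s₃` on `U := ⋃ triangles`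
— force, for `s₃ ≥ 7`, `m = 3`, `s₃ = 7` and `|U| = 7`; then `U` is the star of `x` (`{x} ∪ ⋃ (triangles through x)`
has `1 + 2·3 = 7` points), a triangle `L` avoiding `x` exists (`7 > 3`), its three points lie on the three triangles
`Cₐ, C_b, C_c` through `x` — one on each, since two distinct triangles share at most one point under (C1) — and
`U ⊆ cl(Cₐ ∪ L)`: `C_b ⊆ cl {x, b}` and `C_c ⊆ cl {x, c}` with `x ∈ Cₐ`, `b, c ∈ L`. Submodularity gives
`r(Cₐ ∪ L) ≤ 2 + 2 − 1 = 3`, so `U` is a rank-`≤ 3` set of `7` points, against (C2) (planes have `≤ 6` points).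
Hence **`s₃ ≤ 6` at nullity `4`** (`ncard_triangles_le_six_of_nullity_four`). The re-based bootstrap
`6 → 9 → 13 → 17 → 22` (S1TriangleCountBootSix) replaces `triBound 8 = 24` by `22`, which is what the cell `(42, 8)`
of level `7` needs. Axioms: standard.
-/

open scoped Matroid

namespace PercRepro

namespace S1

open Set

variable {α : Type}

/-- **Two distinct triangles share at most one point** under (C1): two common points `a, b` are equal. -/
theorem eq_of_mem_inter_of_mem_triangles (M : Matroid α) [M.Finite]
    (hC1 : ∀ L ⊆ M.E, M.eRk L = 2 → L.ncard ≤ 3) {C C' : Set α}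
    (hC : C ∈ ThmN.triangles M) (hC' : C' ∈ ThmN.triangles M) (hne : C ≠ C') {a b : α}
    (ha : a ∈ C ∩ C') (hb : b ∈ C ∩ C') : a = b := by
  have h := ThmN.inter_eq_singleton_of_mem_trianglesThrough M hC1 (x := a) ⟨hC.1, hC.2, ha.1⟩
    ⟨hC'.1, hC'.2, ha.2⟩ hne
  rw [h] at hb
  exact (Set.mem_singleton_iff.1 hb).symm

/-- **A triangle lies in the closure of any two of its points.** -/
theorem triangle_subset_closure_of_two_mem (M : Matroid α) [M.Finite] {C : Set α}
    (hC : C ∈ ThmN.triangles M) {u v : α} (hu : u ∈ C) (hv : v ∈ C) (huv : u ≠ v) :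
    C ⊆ M.closure {u, v} := by
  have hCE : C ⊆ M.E := hC.1.subset_ground
  have hCfin : C.Finite := M.ground_finite.subset hCE
  have hpair : ({u, v} : Set α) ⊆ C := by
    intro z hz
    rcases hz with rfl | rfl
    · exact hu
    · exact hv
  have hss : ({u, v} : Set α) ⊂ C := by
    refine hpair.ssubset_of_ne ?_
    intro h
    have := congrArg Set.ncard h
    rw [Set.ncard_pair huv, hC.2] at this
    omega
  have hind : M.Indep ({u, v} : Set α) := hC.1.ssubset_indep hss
  have hr2 : M.eRk ({u, v} : Set α) = 2 := by
    rw [hind.eRk_eq_encard, Set.encard_pair huv]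
  have hrC : M.eRk C = 2 := ThmN.eRk_eq_two_of_mem_trianglesThrough M ⟨hC.1, hC.2, hu⟩
  exact ThmN.subset_closure_of_eRk_le M hpair hCE hCfin (by rw [hrC, hr2])

/-- **THE TRIANGLE KERNEL AT NULLITY `4`.** If `|E| = r(E) + 4`, every rank-`2` set has at most `3` elements (C1) and
every rank-`≤ 3` set has at most `6` elements (C2), then `#(triangles M) ≤ 6`. The bootstrap at the point `x` on the
fewest triangles gives `s₃ ≤ m + 4` and `m(2m + 1) ≤ 3·s₃`; if `s₃ ≥ 7` then `m = 3`, `s₃ = 7`, `|⋃ triangles| = 7`,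
the union is the star of `x`, a triangle `L` avoiding `x` meets each of the three triangles through `x` in one point,
and the union lies in `cl(Cₐ ∪ L)` of rank `≤ 3` — `7` points in a plane, against (C2). -/
theorem ncard_triangles_le_six_of_nullity_four (M : Matroid α) [M.Finite]
    (hC1 : ∀ L ⊆ M.E, M.eRk L = 2 → L.ncard ≤ 3)
    (hC2 : ∀ X ⊆ M.E, M.eRk X ≤ 3 → X.ncard ≤ 6)
    (hd : M.E.encard = M.eRank + 4) : (ThmN.triangles M).ncard ≤ 6 := by
  classical
  set S := ThmN.triangles M with hS
  have hSfin : S.Finite :=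
    M.ground_finite.finite_subsets.subset (fun C hC => hC.1.subset_ground)
  by_cases hSe : S = ∅
  · rw [hSe, ncard_empty]; exact Nat.zero_le _
  -- the point on the fewest triangles
  have hUE : ⋃₀ S ⊆ M.E := by
    intro z hz
    obtain ⟨C, hC, hzC⟩ := Set.mem_sUnion.1 hz
    exact hC.1.subset_ground hzC
  have hUfin : (⋃₀ S).Finite := M.ground_finite.subset hUE
  set Uf : Finset α := hUfin.toFinset with hUf
  have hmemU : ∀ x, x ∈ Uf ↔ x ∈ ⋃₀ S := fun x => Set.Finite.mem_toFinset hUfin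
  have hUne : Uf.Nonempty := by
    obtain ⟨C₀, hC₀⟩ := nonempty_iff_ne_empty.2 hSe
    obtain ⟨e, heC₀⟩ := hC₀.1.nonempty
    exact ⟨e, (hmemU e).2 (Set.mem_sUnion.2 ⟨C₀, hC₀, heC₀⟩)⟩
  obtain ⟨x, hxU, hxmin⟩ := Finset.exists_min_image Uf (fun y => (ThmN.trianglesThrough M y).ncard) hUne
  have hxU' : x ∈ ⋃₀ S := (hmemU x).1 hxU
  obtain ⟨C₀, hC₀, hxC₀⟩ := Set.mem_sUnion.1 hxU'
  set m := (ThmN.trianglesThrough M x).ncard with hm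
  have hmin : ∀ y ∈ ⋃₀ ThmN.triangles M, m ≤ (ThmN.trianglesThrough M y).ncard :=
    fun y hy => hxmin y ((hmemU y).2 hy)
  have heE : x ∈ M.E := hC₀.1.subset_ground hxC₀
  have hne : ¬ M.IsColoop x := hC₀.1.not_isColoop_of_mem hxC₀
  have hx : M.IsNonloop x := by
    refine _root_.Matroid.isNonloop_of_not_isLoop heE ?_
    intro hloop
    have hC₀e : C₀ = {x} := hloop.eq_of_isCircuit_mem hC₀.1 hxC₀
    have := hC₀.2
    rw [hC₀e, ncard_singleton] at this
    omega
  -- the nullity of `M ＼ {x}` is `3`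
  have hν : M✶.eRank = (4 : ℕ∞) := by
    have h := _root_.Matroid.eRank_add_eRank_dual M
    rw [hd] at h
    exact WithTop.add_left_cancel (PercRepro.Matroid.eRank_ne_top_of_finite M) h
  have hdel := PercRepro.Matroid.dual_eRank_delete_singleton_add_one heE hne
  rw [hν] at hdel
  have hfin' : (M ＼ {x})✶.eRank ≠ ⊤ := by
    intro h
    rw [h] at hdel
    exact absurd hdel (by simp)
  obtain ⟨d', hd'⟩ := ENat.ne_top_iff_exists.1 hfin'
  have hdd' : d' + 1 = 4 := by
    rw [← hd'] at hdel
    exact_mod_cast hdel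
  have hd'3 : d' = 3 := by omega
  have hd'enc : (M ＼ {x}).E.encard = (M ＼ {x}).eRank + d' := by
    have h := _root_.Matroid.eRank_add_eRank_dual (M ＼ {x})
    rw [← hd'] at h
    exact h.symm
  have hC1' : ∀ L ⊆ (M ＼ {x}).E, (M ＼ {x}).eRk L = 2 → L.ncard ≤ 3 := by
    intro L hL hr
    rw [_root_.Matroid.delete_ground] at hL
    rw [delete_singleton_eRk_eq hL] at hr
    exact hC1 L (hL.trans sdiff_subset) hr
  -- (a) `s₃ ≤ m + 4`
  set S₁ := ThmN.trianglesThrough M x with hS₁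
  set S₂ := {C | M.IsCircuit C ∧ C.ncard = 3 ∧ x ∉ C} with hS₂
  have hsplit : S ⊆ S₁ ∪ S₂ := by
    intro C hC
    by_cases h : x ∈ C
    · exact Or.inl ⟨hC.1, hC.2, h⟩
    · exact Or.inr ⟨hC.1, hC.2, h⟩
  have hS₁fin : S₁.Finite := hSfin.subset (fun C hC => ⟨hC.1, hC.2.1⟩)
  have hS₂fin : S₂.Finite := hSfin.subset (fun C hC => ⟨hC.1, hC.2.1⟩)
  have h3 : S.ncard ≤ S₁.ncard + S₂.ncard :=
    (ncard_le_ncard hsplit (hS₁fin.union hS₂fin)).trans (ncard_union_le _ _)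
  have hsub : S₂ ⊆ ThmN.triangles (M ＼ {x}) := by
    intro C hC
    exact ⟨_root_.Matroid.delete_isCircuit_iff.2 ⟨hC.1, disjoint_singleton_right.2 hC.2.2⟩, hC.2.1⟩
  have hS₂ : S₂.ncard ≤ 4 := by
    have h := (ncard_le_ncard hsub
      ((M ＼ {x}).ground_finite.finite_subsets.subset (fun C hC => hC.1.subset_ground))).trans
      (ncard_triangles_le_triBound (M ＼ {x}) hC1' hd'enc)
    rw [hd'3] at h
    have h34 : triBound 3 = 4 := by decide
    rw [h34] at h
    exact h
  have ha : S.ncard ≤ m + 4 := by omega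
  -- (b) `m(2m + 1) ≤ 3·s₃`
  have hstar : 1 + 2 * m ≤ (⋃₀ S).ncard := one_add_two_mul_ncard_trianglesThrough_le M hC1 hx hxU'
  have hdc : (⋃₀ S).ncard * m ≤ 3 * S.ncard := ncard_sUnion_mul_le_three_mul_ncard_triangles M hmin
  have hb : m + 2 * m * m ≤ 3 * S.ncard := by
    have h1 : (1 + 2 * m) * m ≤ (⋃₀ S).ncard * m := Nat.mul_le_mul_right m hstar
    have h2 : (1 + 2 * m) * m = m + 2 * m * m := by ring
    rw [h2] at h1
    exact h1.trans hdc
  -- (c) if `s₃ ≥ 7` then `m = 3`, `s₃ = 7`, `|U| = 7`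
  by_contra hcon
  have hcon' : 7 ≤ S.ncard := by omega
  have hm_le : m ≤ 3 := by nlinarith
  have hm3 : m = 3 := by omega
  have hs7 : S.ncard = 7 := by omega
  have hU7 : (⋃₀ S).ncard = 7 := by
    rw [hm3] at hdc hstar
    rw [hs7] at hdc
    omega
  -- the star of `x` is the whole of `U`
  set s : Finset (Set α) := hS₁fin.toFinset with hsdef
  have hs : ∀ C ∈ s, C ∈ ThmN.trianglesThrough M x :=
    fun C hC => (Set.Finite.mem_toFinset hS₁fin).1 hC
  have hscard : s.card = 3 := by
    rw [hsdef, ← Set.ncard_eq_toFinset_card _ hS₁fin]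
    exact hm3
  obtain ⟨-, hstar_card⟩ := ThmN.eRk_le_and_ncard_eq_of_triangles M hC1 hx s hs
  rw [hscard] at hstar_card
  have hsub_star : ({x} ∪ ⋃ C ∈ s, C) ⊆ ⋃₀ S := by
    intro z hz
    rcases hz with hz | hz
    · rw [Set.mem_singleton_iff.1 hz]; exact hxU'
    · obtain ⟨C, hC, hzC⟩ := Set.mem_iUnion₂.1 hz
      exact Set.mem_sUnion.2 ⟨C, ⟨(hs C hC).1, (hs C hC).2.1⟩, hzC⟩
  have hstarU : ({x} ∪ ⋃ C ∈ s, C) = ⋃₀ S :=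
    Set.eq_of_subset_of_ncard_le hsub_star (by rw [hstar_card, hU7]) hUfin
  -- a triangle `L` avoiding `x`
  obtain ⟨L, hL, hxL⟩ : ∃ L ∈ S, x ∉ L := by
    by_contra h
    have hSS₁ : S ⊆ S₁ := fun C hC => ⟨hC.1, hC.2, not_not.1 (fun hx' => h ⟨C, hC, hx'⟩)⟩
    have := ncard_le_ncard hSS₁ hS₁fin
    omega
  -- the three points of `L`
  obtain ⟨a, b, c, hab, hac, hbc, hLabc⟩ := Set.ncard_eq_three.1 hL.2
  have haL : a ∈ L := by rw [hLabc]; simp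
  have hbL : b ∈ L := by rw [hLabc]; simp
  have hcL : c ∈ L := by rw [hLabc]; simp
  -- each lies on a triangle through `x`
  have hpt : ∀ z ∈ L, ∃ C ∈ s, z ∈ C := by
    intro z hz
    have hzU : z ∈ ⋃₀ S := Set.mem_sUnion.2 ⟨L, hL, hz⟩
    rw [← hstarU] at hzU
    rcases hzU with hzx | hz'
    · exfalso
      apply hxL
      rw [Set.mem_singleton_iff] at hzx
      rw [← hzx]
      exact hz
    · obtain ⟨C, hC, hzC⟩ := Set.mem_iUnion₂.1 hz'
      exact ⟨C, hC, hzC⟩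
  obtain ⟨Ca, hCa, haCa⟩ := hpt a haL
  obtain ⟨Cb, hCb, hbCb⟩ := hpt b hbL
  obtain ⟨Cc, hCc, hcCc⟩ := hpt c hcL
  have hLne : ∀ C ∈ s, L ≠ C := fun C hC h => hxL (by rw [h]; exact (hs C hC).2.2)
  have hTa : Ca ∈ ThmN.triangles M := ⟨(hs Ca hCa).1, (hs Ca hCa).2.1⟩
  have hTb : Cb ∈ ThmN.triangles M := ⟨(hs Cb hCb).1, (hs Cb hCb).2.1⟩
  have hTc : Cc ∈ ThmN.triangles M := ⟨(hs Cc hCc).1, (hs Cc hCc).2.1⟩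
  -- `Cₐ, C_b, C_c` are pairwise distinct (two points of `L` on one of them would be two common points)
  have hab' : Ca ≠ Cb := by
    intro h
    rw [h] at haCa
    exact hab (eq_of_mem_inter_of_mem_triangles M hC1 hL hTb (hLne Cb hCb) ⟨haL, haCa⟩ ⟨hbL, hbCb⟩)
  have hac' : Ca ≠ Cc := by
    intro h
    rw [h] at haCa
    exact hac (eq_of_mem_inter_of_mem_triangles M hC1 hL hTc (hLne Cc hCc) ⟨haL, haCa⟩ ⟨hcL, hcCc⟩)
  have hbc' : Cb ≠ Cc := by
    intro h
    rw [h] at hbCb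
    exact hbc (eq_of_mem_inter_of_mem_triangles M hC1 hL hTc (hLne Cc hCc) ⟨hbL, hbCb⟩ ⟨hcL, hcCc⟩)
  have hs_eq : s = {Ca, Cb, Cc} := by
    symm
    apply Finset.eq_of_subset_of_card_le
    · intro C hC
      simp only [Finset.mem_insert, Finset.mem_singleton] at hC
      rcases hC with rfl | rfl | rfl
      · exact hCa
      · exact hCb
      · exact hCc
    · have h3c : ({Ca, Cb, Cc} : Finset (Set α)).card = 3 :=
        Finset.card_eq_three.2 ⟨Ca, Cb, Cc, hab', hac', hbc', rfl⟩
      rw [hscard, h3c]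
  -- the rank of `Cₐ ∪ L` is at most `3`
  have hrCa : M.eRk Ca = 2 := ThmN.eRk_eq_two_of_mem_trianglesThrough M (hs Ca hCa)
  have hrL : M.eRk L = 2 := ThmN.eRk_eq_two_of_mem_trianglesThrough M ⟨hL.1, hL.2, haL⟩
  have ha_nl : M.IsNonloop a := hL.1.isNonloop_of_mem ⟨a, haL, b, hbL, hab⟩ haL
  have h1 : (1 : ℕ∞) ≤ M.eRk (Ca ∩ L) := by
    rw [← ha_nl.eRk_eq]
    exact M.eRk_mono (Set.singleton_subset_iff.2 ⟨haCa, haL⟩)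
  have hsubmod := M.eRk_inter_add_eRk_union_le Ca L
  rw [hrCa, hrL] at hsubmod
  have h2 : (1 : ℕ∞) + M.eRk (Ca ∪ L) ≤ 4 := by
    calc (1 : ℕ∞) + M.eRk (Ca ∪ L) ≤ M.eRk (Ca ∩ L) + M.eRk (Ca ∪ L) := add_le_add h1 le_rfl
      _ ≤ 2 + 2 := hsubmod
      _ = 4 := by norm_num
  have hfinCL : M.eRk (Ca ∪ L) ≠ ⊤ := by
    intro h
    rw [h] at h2
    exact absurd h2 (by simp)
  obtain ⟨r, hr⟩ := ENat.ne_top_iff_exists.1 hfinCL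
  have hr3 : M.eRk (Ca ∪ L) ≤ 3 := by
    rw [← hr] at h2 ⊢
    have h2' : 1 + r ≤ 4 := by exact_mod_cast h2
    exact_mod_cast (show r ≤ 3 by omega)
  -- `C_b` and `C_c` lie in the closure of `Cₐ ∪ L`, hence so does `U`
  have hCaL_E : Ca ∪ L ⊆ M.E := Set.union_subset hTa.1.subset_ground hL.1.subset_ground
  have hxCa : x ∈ Ca := (hs Ca hCa).2.2
  have hxb : x ≠ b := fun h => hxL (by rw [h]; exact hbL)
  have hxc : x ≠ c := fun h => hxL (by rw [h]; exact hcL)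
  have hCb_cl : Cb ⊆ M.closure (Ca ∪ L) := by
    refine (triangle_subset_closure_of_two_mem M hTb (hs Cb hCb).2.2 hbCb hxb).trans ?_
    apply M.closure_subset_closure
    intro z hz
    rcases hz with rfl | rfl
    · exact Or.inl hxCa
    · exact Or.inr hbL
  have hCc_cl : Cc ⊆ M.closure (Ca ∪ L) := by
    refine (triangle_subset_closure_of_two_mem M hTc (hs Cc hCc).2.2 hcCc hxc).trans ?_
    apply M.closure_subset_closure
    intro z hz
    rcases hz with rfl | rfl
    · exact Or.inl hxCa
    · exact Or.inr hcL
  have hUcl : ⋃₀ S ⊆ M.closure (Ca ∪ L) := by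
    rw [← hstarU]
    intro z hz
    rcases hz with hz | hz
    · rw [Set.mem_singleton_iff.1 hz]
      exact M.subset_closure (Ca ∪ L) hCaL_E (Or.inl hxCa)
    · obtain ⟨C, hC, hzC⟩ := Set.mem_iUnion₂.1 hz
      rw [hs_eq] at hC
      simp only [Finset.mem_insert, Finset.mem_singleton] at hC
      rcases hC with rfl | rfl | rfl
      · exact M.subset_closure _ hCaL_E (Or.inl hzC)
      · exact hCb_cl hzC
      · exact hCc_cl hzC
  have hrU : M.eRk (⋃₀ S) ≤ 3 := by
    calc M.eRk (⋃₀ S) ≤ M.eRk (M.closure (Ca ∪ L)) := M.eRk_mono hUcl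
      _ = M.eRk (Ca ∪ L) := M.eRk_closure_eq _
      _ ≤ 3 := hr3
  have h6 := hC2 _ hUE hrU
  omega

end S1

end PercRepro
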